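import Summits.RiemannHypothesis.RiemannHypothesis.Theorems.S2FormatCDefs
import Literature.NumberTheory.LFunctions.PsdDyadicCertificate
import Literature.NumberTheory.LFunctions.WeilSemilocalQuadratic
import Literature.NumberTheory.LFunctions.YoshidaWindowSpaces
import Summits.RiemannHypothesis.RiemannHypothesis.Theorems.MotivicDoorSemilocalMarkov
import Summits.RiemannHypothesis.RiemannHypothesis.Theorems.MotivicDoorSemilocalThreshold
import Summits.RiemannHypothesis.RiemannHypothesis.Theorems.WeilFormatCSchurStepDiag
import HarnessLib

/-!
# Format C at `S = {∞, 2}` — statement SHAPES: window form, named analysis statements, Schur objects, (P)+(E) glue,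
# and the end-to-end composition BY NAME

Seat cc-s2-4 (`HOME/cc-s2-4/CC4-LEAN.md` §7.1).  §2 the `{∞,2}` window form `windowFormTwo` (= `Re Q_{2}` on `C(b)`,
`b ≤ log 2`, PROVED) and the named statements `EntryTheoremTwo` / `DictionaryTwo` / `SectorSplitTwo`; §3 the Schur objects
(`SectorData`, `tailU`, `schurS`, `gammaFar`, `FarCoercivityTwo`, `ColumnTailTwo`); §4 the enclosure shape
`EntrywiseEnclosed` (= the `hM` hypothesis of `PsdDyadic.psd_of_checkPsdMid`), `enclosed_of_mem`, `blockStep_of_check`,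
`coupling_le_tailU`, the row-band shapes; §5 `SectorReductionTwo` and `le_threshold_of_formatC`
((P)+(E) certificates + the named statements ⇒ `WeilSemilocalPositivityOn {2} b ∧ b ≤ a*({2})`).
`EntryTheoremTwo` and `SectorSplitTwo` are proved in `S2FormatCBridge`; the (E) engine is `S2FormatCGI/EntryEval/SchurEval`;
the (E0) table checker is `S2FormatCE0*`.
-/

set_option linter.dupNamespace false
set_option autoImplicit false

noncomputable section

open Complex Set MeasureTheory Filter Finset Matrix
open scoped Real Topology ComplexConjugate BigOperators

namespace Summit.RiemannHypothesis.RiemannHypothesis.Theorems.S2FormatC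

open Literature.NumberTheory.LFunctions Literature.Analysis.SpecialFunctions
open Summit.RiemannHypothesis.RiemannHypothesis.Theorems.MotivicDoor.SemilocalMarkov
open Summit.RiemannHypothesis.RiemannHypothesis.Theorems.MotivicDoor.SemilocalThreshold

/-! ## §2 The `{∞,2}` window form and the entry theorem (L-C1 at `S = {2}`) -/

/-- **The `{∞,2}` window form in position space** `P(u) + Λ·D_{log 2}(u) + ∫₀^∞ w·D_t(u) dt − C₂‖u‖²`, defined for
EVERY `u : ℝ → ℂ` (in particular on `K(b)` and on the trigonometric windows `Σ c_n χ_n`); window-independent. -/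
def windowFormTwo (u : ℝ → ℂ) : ℝ :=
  weilPoleForm u + lam * weilIncrement u (Real.log 2) +
    (∫ t in Ioi (0 : ℝ), weilArchDensity t * weilIncrement u t) - semilocalTwoConstant * ∫ x : ℝ, ‖u x‖ ^ 2

/-- On `C(b)`, `b ≤ log 2`, the window form IS `Re Q_{{2}}` (the tree's `{∞,2}` Markov decomposition). PROVED. -/
theorem windowFormTwo_eq_re {g : ℝ → ℂ} {b : ℝ} (hg : IsWeilTest g) (hsupp : tsupport g ⊆ Icc (-b) b)
    (hb : b ≤ Real.log 2) : windowFormTwo g = (weilSemilocalQuadratic {2} g).re := by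
  rw [windowFormTwo, lam, re_weilSemilocalQuadratic_two_eq hg hsupp hb]

/-- The trigonometric window `Σ_{|n| ≤ N} c_n χ_n` on `[−b,b]`. -/
def trigWindow (b : ℝ) (N : ℕ) (c : ℤ → ℂ) : ℝ → ℂ :=
  ∑ n ∈ Yoshida1992.modes N, c n • Yoshida1992.chi b n

/-- **ENTRY THEOREM, `S = {2}` (statement; = L-C1 with prime list `{2}`; NOT proved here).**  On every trigonometric
window the `{∞,2}` window form is the Hermitian form of the closed-form matrix `gram b`:
`windowFormTwo (Σ c_n χ_n) = Σ_{n,m} Re(conj c_n · c_m) · G₂(n,m)` for `(log 2)/2 < b ≤ log 2`. -/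
def EntryTheoremTwo (b : ℝ) : Prop :=
  ∀ (N : ℕ) (c : ℤ → ℂ), windowFormTwo (trigWindow b N c) =
    ∑ n ∈ Yoshida1992.modes N, ∑ m ∈ Yoshida1992.modes N, (conj (c n) * c m).re * gram b n m

/-- **DICTIONARY, `S = {2}` (statement; = cc-s2-2's semilocal L-C4 twin; NOT proved here).**  Positivity of the window
form on all trigonometric windows of `[−b,b]` gives `{∞,2}`-positivity on the cone `C(b)` (`0 < b ≤ log 2`):
density of trigonometric polynomials in `K(b)` for the form + `C(b) ⊂ K(b)` + `windowFormTwo_eq_re`. -/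
def DictionaryTwo (b : ℝ) : Prop :=
  (∀ (N : ℕ) (c : ℤ → ℂ), 0 ≤ windowFormTwo (trigWindow b N c)) → WeilSemilocalPositivityOn {2} b

/-- **SECTOR SPLIT (statement; parity bookkeeping, part of L-C1/L-C4; NOT proved here).**  The Hermitian form of
`gram b` on `modes N` is nonnegative as soon as both real sector forms are: `G(n,m) = G(−n,−m)` real symmetric, so
`c ↦ (c_n ± c_{−n})/√2` block-diagonalises it into `gramEven`/`gramOdd`, and real PSD ⇒ Hermitian PSD. -/
def SectorSplitTwo (b : ℝ) : Prop :=
  (∀ (N : ℕ) (x : ℕ → ℝ), 0 ≤ ∑ n ∈ range (N + 1), ∑ m ∈ range (N + 1), x n * x m * gramEven b n m) →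
  (∀ (N : ℕ) (x : ℕ → ℝ), 0 ≤ ∑ n ∈ Icc 1 N, ∑ m ∈ Icc 1 N, x n * x m * gramOdd b n m) →
    ∀ (N : ℕ) (c : ℤ → ℂ),
      0 ≤ ∑ n ∈ Yoshida1992.modes N, ∑ m ∈ Yoshida1992.modes N, (conj (c n) * c m).re * gram b n m

/-! ## §3 The Schur objects (L-C3 at `S = {2}`): columns, order-2 tail majorant, far coercivity, `S = G_W − U/γ` -/

/-- Far coupling column entry `b_m(n) = W^σ(n, m)` (`n ≤ M₁ < m`). -/
def col (odd : Bool) (b : ℝ) (n m : ℕ) : ℝ := gramSector odd b n m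

/-- `g_m = 1 + (4/π) Λ sin(ω_m log 2)` (leading column amplitude, even sector; odd: second order). -/
def gLead (b : ℝ) (m : ℕ) : ℝ := 1 + 4 / π * lam * Real.sin (omega b m * Real.log 2)

/-- Leading scalars `α_m` (`even: g_m/m`, `odd: 1/m`) of `b_m = (−1)^m(α_m p + β_m q) + r_m`. -/
def alpha (odd : Bool) (b : ℝ) (m : ℕ) : ℝ := if odd then 1 / m else gLead b m / m

/-- Second-order scalars `β_m` (`even: 1/m²`, `odd: g_m/(2m²)`). -/
def beta (odd : Bool) (b : ℝ) (m : ℕ) : ℝ := if odd then gLead b m / (2 * m ^ 2) else 1 / m ^ 2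

/-- Odd leading direction `v_n = [−y_n − 2Λ sin ω_n log 2 + 2ω_n S0_n]/π − (8s²/π) ω_n/(1+4ω_n²)`. -/
def vOdd (b : ℝ) (n : ℕ) : ℝ :=
  (-imPsi b n - 2 * lam * Real.sin (omega b n * Real.log 2) + 2 * omega b n * S0 b n) / π -
    8 * sSq b / π * omega b n / (1 + 4 * omega b n ^ 2)

/-- Even second-order direction `q_n = 2s²b c_n/π² − 2b S2_n/π² + b/(2π²) − n y_n/π − (2n/π)Λ sin(ω_n log 2)`,
`c_n = 1/(1+4ω_n²)`; `q₀′ = s²b/π² − b S2_0/π² + b/(4π²)`. -/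
def qEven (b : ℝ) (n : ℕ) : ℝ :=
  if n = 0 then sSq b * b / π ^ 2 - b * S2 b 0 / π ^ 2 + b / (4 * π ^ 2)
  else 2 * sSq b * b / (1 + 4 * omega b n ^ 2) / π ^ 2 - 2 * b * S2 b n / π ^ 2 + b / (2 * π ^ 2) -
    n * imPsi b n / π - 2 * n / π * lam * Real.sin (omega b n * Real.log 2)

/-- Leading direction `p` (even: `1/(2√2)` at `n = 0`, `(−1)^n/2`; odd: `(−1)^n v_n`). -/
def pVec (odd : Bool) (b : ℝ) (n : ℕ) : ℝ :=
  if odd then sgn n * vOdd b n else if n = 0 then 1 / (2 * Real.sqrt 2) else sgn n / 2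

/-- Second direction `q` (even: `√2 q₀′` at `n = 0`, `(−1)^n q_n`; odd: `(−1)^n n`). -/
def qVec (odd : Bool) (b : ℝ) (n : ℕ) : ℝ :=
  if odd then sgn n * n else if n = 0 then Real.sqrt 2 * qEven b 0 else sgn n * qEven b n

/-- `Y = π/2 + 2/ω₁ ≥ |y_n|` (edge digamma bound (D1), tree `abs_im_digamma_sub_pi_div_two_le`). -/
def yBound (b : ℝ) : ℝ := π / 2 + 2 / omega b 1

/-- `A(μ) = 2Λ` (pointwise prime dip of the `{∞,2}` form on `(log 2)/2 < b ≤ log 2`). -/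
def aMu : ℝ := 2 * lam

/-- Order-2 remainder constants `κ₃(n)` (`|r_m(n)| ≤ κ₃(n)/m³`, `m ≥ 2M₁`), FORMATC-DESIGN §4.6, with `A(μ) = 2Λ`:
even `n ≥ 1`: `s²b³c_n/(4π⁴n) + 4bEn/(3π²) + b³E₂/(π⁴n) + 2n²/3 + (b/(2π²) + nY/π)(2n/3) + 0.02b³/n + 2A(μ)n²/π`;
even `n = 0`: `√2(s²b³/(4π⁴) + b³E₂/π⁴ + 0.015b³)`; odd: `2s²b²d_n/π³ + (14/3)nEb/π² + nb/(2π²) + 0.03nb³ +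
4Yn²/(3π) + n²/3 + 2n²b/(3π²) + 2A(μ)n²/π`, `d_n = ω_n/(1+4ω_n²)`. -/
def kappa3 (odd : Bool) (b : ℝ) (n : ℕ) : ℝ :=
  if odd then
    2 * sSq b * b ^ 2 * (omega b n / (1 + 4 * omega b n ^ 2)) / π ^ 3 + 14 / 3 * n * eTot b * b / π ^ 2 +
      n * b / (2 * π ^ 2) + 3 / 100 * n * b ^ 3 + 4 * yBound b * n ^ 2 / (3 * π) + n ^ 2 / 3 +
      2 * n ^ 2 * b / (3 * π ^ 2) + 2 * aMu * n ^ 2 / π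
  else if n = 0 then Real.sqrt 2 * (sSq b * b ^ 3 / (4 * π ^ 4) + b ^ 3 * eTwo b / π ^ 4 + 15 / 1000 * b ^ 3)
  else sSq b * b ^ 3 / (1 + 4 * omega b n ^ 2) / (4 * π ^ 4 * n) + 4 * b * eTot b * n / (3 * π ^ 2) +
      b ^ 3 * eTwo b / (π ^ 4 * n) + 2 * n ^ 2 / 3 + (b / (2 * π ^ 2) + n * yBound b / π) * (2 * n / 3) +
      2 / 100 * b ^ 3 / n + 2 * aMu * n ^ 2 / π

/-- Data of one sector certificate: block cut `M₁`, exact-column cut `M₃`, scalar-tail cut `M₄`, splitting parameters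
`θ, θ₂ > 0`, the tail Gram `F = Σ_{M₃<m≤M₄}(α², αβ; αβ, β²)` (an UPPER enclosure entrywise in the PSD sense is what
L-C3b needs: `Ftrue ⪯ F`), and scalar tails `s₁ ≥ Σ_{m>M₄} α_m²`, `s₂ ≥ Σ_{m>M₄} β_m²`. -/
structure SectorData where
  /-- sector -/
  odd : Bool
  /-- block cut `M₁` (modes `≤ M₁`, from `1` in the odd sector, from `0` in the even sector) -/
  M₁ : ℕ
  /-- exact-column cut -/
  M₃ : ℕ
  /-- scalar-tail cut -/
  M₄ : ℕ
  /-- rank-one splitting parameters -/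
  θ : ℝ
  θ₂ : ℝ
  /-- tail Gram of `(α, β)` over `(M₃, M₄]` -/
  F₁₁ : ℝ
  F₁₂ : ℝ
  F₂₂ : ℝ
  /-- scalar tails beyond `M₄` -/
  s₁ : ℝ
  s₂ : ℝ
  /-- far-coercivity constant used (`≤ gammaFar`) -/
  γ : ℝ

/-- Block dimension: `M₁ + 1` modes `0..M₁` (even), `M₁` modes `1..M₁` (odd). -/
def SectorData.dim (D : SectorData) : ℕ := if D.odd then D.M₁ else D.M₁ + 1

/-- Mode number of block index `i`. -/
def SectorData.mode (D : SectorData) (i : Fin D.dim) : ℕ := if D.odd then i.1 + 1 else i.1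

/-- **The tail majorant** `U = Σ_{M₁<m≤M₃} b_m b_mᵀ + (1+θ)([p q]F[p q]ᵀ + (1+θ₂)s₁ppᵀ + (1+1/θ₂)s₂qqᵀ)
`+ (1+1/θ) n_B diag(κ₃²)/(5M₃⁵)` (FORMATC-DESIGN §4.6) at `S = {2}`, as a function of block indices. -/
def tailU (D : SectorData) (b : ℝ) (i j : Fin D.dim) : ℝ :=
  (∑ m ∈ Ioc D.M₁ D.M₃, col D.odd b (D.mode i) m * col D.odd b (D.mode j) m) +
  (1 + D.θ) * (D.F₁₁ * pVec D.odd b (D.mode i) * pVec D.odd b (D.mode j) +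
      D.F₁₂ * (pVec D.odd b (D.mode i) * qVec D.odd b (D.mode j) + qVec D.odd b (D.mode i) * pVec D.odd b (D.mode j)) +
      D.F₂₂ * qVec D.odd b (D.mode i) * qVec D.odd b (D.mode j) +
    (1 + D.θ₂) * D.s₁ * pVec D.odd b (D.mode i) * pVec D.odd b (D.mode j) +
    (1 + 1 / D.θ₂) * D.s₂ * qVec D.odd b (D.mode i) * qVec D.odd b (D.mode j)) +
  (if i = j then (1 + 1 / D.θ) * D.dim * kappa3 D.odd b (D.mode i) ^ 2 / (5 * (D.M₃ : ℝ) ^ 5) else 0)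

/-- The block Gram `G_W` as a function of block indices. -/
def blockG (D : SectorData) (b : ℝ) (i j : Fin D.dim) : ℝ := gramSector D.odd b (D.mode i) (D.mode j)

/-- **The Schur matrix** `S = G_W − U/γ` — THE matrix whose entries the (E) files enclose and whose PSD-ness the (P)
files certify. -/
def schurS (D : SectorData) (b : ℝ) (i j : Fin D.dim) : ℝ := blockG D b i j - tailU D b i j / D.γ

/-- `h_sup(M₁) = sup_{n > M₁} [(π/2 − arctan √(M₁/n)) − (Re ψ(¼+iω_n/2) − Re ψ(¼+iω_{M₁+1}/2))]` (odd Hilbert part). -/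
def hSup (b : ℝ) (M₁ : ℕ) : ℝ :=
  ⨆ n : {n : ℕ // M₁ < n}, (π / 2 - Real.arctan (Real.sqrt (M₁ / (n : ℕ))) - (rePsi b n - rePsi b (M₁ + 1)))

/-- **Far-coercivity constant** (L-C3a at `S = {2}`): `Re ψ(¼+iω_{M₁+1}/2) − log π − 1/(bω_{M₁+1}) − 2E/(bω²_{M₁+1})
− b/(π²(M₁+1)²) − Λ − 4b/(π√(3M₁)) − 2√2Eb/(π√(3M₁))` `[− 2s²b/(π²M₁) − h_sup(M₁)]_{odd}`
(path-graph bound: `A_op⁺ = Λ·2cos(π/3) = Λ` for `(log 2)/2 < b < log 2`). -/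
def gammaFar (odd : Bool) (b : ℝ) (M₁ : ℕ) : ℝ :=
  rePsi b (M₁ + 1) - Real.log π - 1 / (b * omega b (M₁ + 1)) - 2 * eTot b / (b * omega b (M₁ + 1) ^ 2) -
      b / (π ^ 2 * ((M₁ : ℝ) + 1) ^ 2) - lam - 4 * b / (π * Real.sqrt (3 * M₁)) -
      2 * Real.sqrt 2 * eTot b * b / (π * Real.sqrt (3 * M₁)) -
    if odd then 2 * sSq b * b / (π ^ 2 * M₁) + hSup b M₁ else 0

/-- Index set of a sector truncated at `N`: modes `0..N` (even) / `1..N` (odd). -/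
def sectorModes (odd : Bool) (N : ℕ) : Finset ℕ := if odd then Icc 1 N else range (N + 1)

/-- The real sector form truncated at `N`: `Σ_{n,m} x_n x_m W^σ(n,m)`. -/
def sectorForm (odd : Bool) (b : ℝ) (N : ℕ) (x : ℕ → ℝ) : ℝ :=
  ∑ n ∈ sectorModes odd N, ∑ m ∈ sectorModes odd N, x n * x m * gramSector odd b n m

/-- **FAR COERCIVITY, `S = {2}` (statement = L-C3a instance; NOT proved here).**  The far sector Gram (modes `> M₁`)
is bounded below by `gammaFar` as an `ℓ²` form: for every `N` and every real `y` supported on `(M₁, N]`,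
`Σ_{n,m ∈ (M₁,N]} y_n y_m W^σ(n,m) ≥ γ_far · Σ y_n²`. -/
def FarCoercivityTwo (odd : Bool) (b : ℝ) (M₁ : ℕ) : Prop :=
  ∀ (N : ℕ) (y : ℕ → ℝ), gammaFar odd b M₁ * ∑ m ∈ Ioc M₁ N, y m ^ 2 ≤
    ∑ n ∈ Ioc M₁ N, ∑ m ∈ Ioc M₁ N, y n * y m * gramSector odd b n m

/-- **COLUMN TAIL, `S = {2}` (statement = L-C3b instance + the order-2 model; NOT proved here).**  `tailU` majorises
the full far coupling Gram in every block direction: for every `N` and block vector `x`,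
`Σ_{M₁<m≤N} (Σ_i x_i b_m(i))² ≤ xᵀ U x`. -/
def ColumnTailTwo (D : SectorData) (b : ℝ) : Prop :=
  ∀ (N : ℕ) (x : Fin D.dim → ℝ),
    ∑ m ∈ Ioc D.M₁ N, (∑ i, x i * col D.odd b (D.mode i) m) ^ 2 ≤ x ⬝ᵥ (Matrix.of (tailU D b)) *ᵥ x

/-! ## §4 The enclosure shape and the (P)+(E) glue -/

/-- **THE (E) STATEMENT SHAPE.**  `M` is enclosed entrywise by integer midpoints `mid` at unit `u` with radius `ρ`:
`|M i j − mid_ij·u| ≤ ρ·u` — literally the hypothesis `hM` of `PsdDyadic.psd_of_checkPsdMid` (R5-11: `u = 2^(−2C)`). -/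
def EntrywiseEnclosed {d : ℕ} (M : Fin d → Fin d → ℝ) (mid : List (List ℤ)) (ρ : ℤ) (u : ℝ) : Prop :=
  ∀ i j, |M i j - (PsdDyadic.getMZ mid i j : ℝ) * u| ≤ (ρ : ℝ) * u

/-- Per-entry discharge from a kernel interval at scale `S` (`u = 1/S`): if `x·S ∈ [I.lo, I.hi]` (`MI.mem`) and the
integers satisfy `mid − ρ ≤ I.lo`, `I.hi ≤ mid + ρ` (two `decide`s), then `|x − mid/S| ≤ ρ/S`.  PROVED. -/
theorem enclosed_of_mem {S : ℕ} (hS : 0 < S) {x : ℝ} {I : Literature.Analysis.ValidatedNumerics.NumericsMP.MI}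
    (hx : Literature.Analysis.ValidatedNumerics.NumericsMP.MI.mem S x I) {mid ρ : ℤ}
    (hlo : mid - ρ ≤ I.lo) (hhi : I.hi ≤ mid + ρ) :
    |x - (mid : ℝ) * (1 / S)| ≤ (ρ : ℝ) * (1 / S) := by
  have hS' : (0 : ℝ) < S := by exact_mod_cast hS
  obtain ⟨h1, h2⟩ := hx
  have hlo' : ((mid : ℝ) - ρ) ≤ x * S := by
    have : ((mid - ρ : ℤ) : ℝ) ≤ (I.lo : ℝ) := by exact_mod_cast hlo
    push_cast at this; linarith
  have hhi' : x * S ≤ (mid : ℝ) + ρ := by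
    have : (I.hi : ℝ) ≤ ((mid + ρ : ℤ) : ℝ) := by exact_mod_cast hhi
    push_cast at this; linarith
  rw [abs_le]
  constructor
  · have : ((mid : ℝ) - ρ) * (1 / S) ≤ x := by
      rw [← div_eq_mul_one_div, div_le_iff₀ hS']; exact hlo'
    linarith [this]
  · have : x ≤ ((mid : ℝ) + ρ) * (1 / S) := by
      rw [← div_eq_mul_one_div, le_div_iff₀ hS']; exact hhi'
    linarith [this]

/-- Double sums vs. `dotProduct`/`mulVec`. -/
theorem sum_sum_eq_dotProduct_mulVec {d : ℕ} (M : Fin d → Fin d → ℝ) (x : Fin d → ℝ) :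
    ∑ i, ∑ j, x i * x j * M i j = x ⬝ᵥ (Matrix.of M) *ᵥ x := by
  simp only [dotProduct, mulVec, Matrix.of_apply, Finset.mul_sum]
  refine Finset.sum_congr rfl fun i _ ↦ Finset.sum_congr rfl fun j _ ↦ ?_
  ring

/-- **(P) ∧ (E) ⇒ block step.**  A checked `PsdDyadic` certificate for the enclosed Schur matrix `G_W − U/γ` gives
`xᵀ(U/γ)x ≤ xᵀG_Wx` for every block vector — the hypothesis `hS` of `WeilFormatC.schurStepDiag_nonneg` with the
flat far bound `d ≡ γ`.  PROVED (from `PsdDyadic.psd_of_checkPsdMid`). -/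
theorem blockStep_of_check (D : SectorData) (b : ℝ) {δ ρ : ℤ} {mid L : List (List ℤ)} {u : ℝ}
    (hP : PsdDyadic.checkPsdMid D.dim δ ρ mid L = true) (hu : 0 < u)
    (hE : EntrywiseEnclosed (schurS D b) mid ρ u) (x : Fin D.dim → ℝ) :
    x ⬝ᵥ (Matrix.of fun i j ↦ tailU D b i j / D.γ) *ᵥ x ≤ x ⬝ᵥ (Matrix.of (blockG D b)) *ᵥ x := by
  have h := PsdDyadic.psd_of_checkPsdMid hP hu (schurS D b) hE x
  rw [sum_sum_eq_dotProduct_mulVec] at h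
  have hsplit : (Matrix.of (schurS D b)) =
      Matrix.of (blockG D b) - Matrix.of (fun i j ↦ tailU D b i j / D.γ) := by
    ext i j; simp [schurS]
  rw [hsplit, sub_mulVec, dotProduct_sub] at h
  linarith

/-- The same in `Σ c_m²/γ ≤ xᵀ(U/γ)x` form: with `ColumnTailTwo` the coupling coefficients `c_m = Σ_i x_i b_m(i)` of any
finite far range satisfy the hypothesis `hU` of `WeilFormatC.schurStepDiag_nonneg` (`d ≡ γ > 0`).  PROVED. -/
theorem coupling_le_tailU (D : SectorData) (b : ℝ) (hγ : 0 < D.γ) (hT : ColumnTailTwo D b) (N : ℕ)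
    (x : Fin D.dim → ℝ) :
    ∑ m ∈ Ioc D.M₁ N, (∑ i, x i * col D.odd b (D.mode i) m) ^ 2 / D.γ ≤
      x ⬝ᵥ (Matrix.of fun i j ↦ tailU D b i j / D.γ) *ᵥ x := by
  have h := hT N x
  have hdiv : x ⬝ᵥ (Matrix.of fun i j ↦ tailU D b i j / D.γ) *ᵥ x = (x ⬝ᵥ (Matrix.of (tailU D b)) *ᵥ x) / D.γ := by
    rw [← sum_sum_eq_dotProduct_mulVec, ← sum_sum_eq_dotProduct_mulVec, Finset.sum_div]
    refine Finset.sum_congr rfl fun i _ ↦ ?_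
    rw [Finset.sum_div]
    refine Finset.sum_congr rfl fun j _ ↦ ?_
    ring
  rw [hdiv, ← Finset.sum_div]
  exact div_le_div_of_nonneg_right h hγ.le

/-! ## §4b Row-band shapes (what an (E) row-band file proves) -/

section EInputs
open Literature.Analysis.ValidatedNumerics.NumericsMP

/-- **Shape of a row-band (E) file**: on the rows `i₀ ≤ i < i₀ + k` every Schur entry is enclosed at scale `S`. -/
def RowBandEnclosed (D : SectorData) (b : ℝ) (mid : List (List ℤ)) (ρ : ℤ) (S : ℕ) (i₀ k : ℕ) : Prop :=
  ∀ i j : Fin D.dim, i₀ ≤ i.1 → i.1 < i₀ + k →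
    |schurS D b i j - (PsdDyadic.getMZ mid i j : ℝ) * (1 / S)| ≤ (ρ : ℝ) * (1 / S)

/-- **Shape of the per-file theorem an (E) row-band file proves** (the generator emits its interval mirror of
`schurS` restricted to the band, evaluated on the table `T`; soundness of the mirror is ONE generic theorem, the
`mem`-calculus of `NumericsMP`; the file then closes each entry with `enclosed_of_mem`). -/
def RowBandFileShape (D : SectorData) (b : ℝ) (T : EntryInputs) (mid : List (List ℤ)) (ρ : ℤ) (i₀ k : ℕ) : Prop :=
  T.Valid b → RowBandEnclosed D b mid ρ T.S i₀ k

/-- (E∞) assembly: bands covering all rows give `EntrywiseEnclosed` at `u = 1/S`. PROVED. -/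
theorem entrywiseEnclosed_of_bands (D : SectorData) (b : ℝ) (mid : List (List ℤ)) (ρ : ℤ) (S : ℕ)
    (bands : List (ℕ × ℕ)) (hcover : ∀ i < D.dim, ∃ bk ∈ bands, bk.1 ≤ i ∧ i < bk.1 + bk.2)
    (hbands : ∀ bk ∈ bands, RowBandEnclosed D b mid ρ S bk.1 bk.2) :
    EntrywiseEnclosed (schurS D b) mid ρ (1 / S) := by
  intro i j
  obtain ⟨bk, hbk, h1, h2⟩ := hcover i.1 i.2
  exact hbands bk hbk i j h1 h2

end EInputs

/-! ## §5 End-to-end composition BY NAME -/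

/-- **SECTOR REDUCTION, `S = {2}` (statement = L-C3c instance assembled; NOT proved here).**  For a sector: entry theorem
bookkeeping + far coercivity + column tail + the certified block step give positivity of the truncated sector form
at every `N` (modes `≤ M₁` are `x`, modes in `(M₁, N]` are `y`; `schurStepDiag_nonneg` with `d ≡ γ`). The only
non-algebraic input beyond the three named statements is `0 < γ ≤ gammaFar`. -/
def SectorReductionTwo (D : SectorData) (b : ℝ) : Prop :=
  FarCoercivityTwo D.odd b D.M₁ → ColumnTailTwo D b → 0 < D.γ → D.γ ≤ gammaFar D.odd b D.M₁ →
    (∀ x : Fin D.dim → ℝ,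
      x ⬝ᵥ (Matrix.of fun i j ↦ tailU D b i j / D.γ) *ᵥ x ≤ x ⬝ᵥ (Matrix.of (blockG D b)) *ᵥ x) →
    ∀ (N : ℕ) (x : ℕ → ℝ), 0 ≤ sectorForm D.odd b N x

/-- **What the verified S = {2} certificate closes, by name.**  Given the analysis layer as named statements
(`EntryTheoremTwo`, `SectorSplitTwo`, `DictionaryTwo`, and per sector `FarCoercivityTwo`, `ColumnTailTwo`,
`SectorReductionTwo` with `0 < γ ≤ gammaFar`) and, per sector, a checked `PsdDyadic` certificate (P) of the
entrywise-enclosed (E) Schur matrix `schurS`, the window `b` is `{∞,2}`-positive and hence `b ≤ a*({2})`.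
PROVED modulo the named statements (they are hypotheses). -/
theorem le_threshold_of_formatC {b : ℝ} (De Do : SectorData) (hDe : De.odd = false) (hDo : Do.odd = true)
    (hEntry : EntryTheoremTwo b) (hSplit : SectorSplitTwo b) (hDict : DictionaryTwo b)
    (hFe : FarCoercivityTwo false b De.M₁) (hTe : ColumnTailTwo De b) (hγe : 0 < De.γ)
    (hγe' : De.γ ≤ gammaFar false b De.M₁) (hRe : SectorReductionTwo De b)
    (hFo : FarCoercivityTwo true b Do.M₁) (hTo : ColumnTailTwo Do b) (hγo : 0 < Do.γ)
    (hγo' : Do.γ ≤ gammaFar true b Do.M₁) (hRo : SectorReductionTwo Do b)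
    {δe ρe δo ρo : ℤ} {mide Le mido Lo : List (List ℤ)} {ue uo : ℝ}
    (hPe : PsdDyadic.checkPsdMid De.dim δe ρe mide Le = true) (hue : 0 < ue)
    (hEe : EntrywiseEnclosed (schurS De b) mide ρe ue)
    (hPo : PsdDyadic.checkPsdMid Do.dim δo ρo mido Lo = true) (huo : 0 < uo)
    (hEo : EntrywiseEnclosed (schurS Do b) mido ρo uo) :
    WeilSemilocalPositivityOn {2} b ∧ b ≤ weilSemilocalThreshold {2} := by
  have hEven : ∀ (N : ℕ) (x : ℕ → ℝ), 0 ≤ sectorForm false b N x := by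
    have h := hRe (hDe ▸ hFe) hTe hγe (hDe ▸ hγe') (blockStep_of_check De b hPe hue hEe)
    rw [hDe] at h; exact h
  have hOdd : ∀ (N : ℕ) (x : ℕ → ℝ), 0 ≤ sectorForm true b N x := by
    have h := hRo (hDo ▸ hFo) hTo hγo (hDo ▸ hγo') (blockStep_of_check Do b hPo huo hEo)
    rw [hDo] at h; exact h
  have hHerm := hSplit (fun N x ↦ by simpa [sectorForm, sectorModes, gramSector] using hEven N x)
    (fun N x ↦ by simpa [sectorForm, sectorModes, gramSector] using hOdd N x)
  have hPos : WeilSemilocalPositivityOn {2} b :=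
    hDict fun N c ↦ by rw [hEntry N c]; exact hHerm N c
  exact ⟨hPos, le_weilSemilocalThreshold hPos⟩


end Summit.RiemannHypothesis.RiemannHypothesis.Theorems.S2FormatC

end
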